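import Literature.AlgebraicGeometry.Motives.FrobeniusTraceProofs
import Mathlib.LinearAlgebra.Matrix.Kronecker
import Mathlib.RingTheory.PowerSeries.Inverse
import Mathlib.Analysis.SpecificLimits.Normed
import Mathlib.Analysis.Normed.Ring.InfiniteSum
import Mathlib.Analysis.Complex.Polynomial.Basic
import HarnessLib

/-!
# Deligne's *Weil I*, §3 ("La majoration fondamentale"): the elementary lemmas of Rankin's method

Deligne, *La conjecture de Weil. I*, Publ. Math. IHÉS 43 (1974), §3, proves the fundamental
estimate, Théorème (3.2): for a lisse `ℚ_ℓ`-sheaf `ℱ₀` on a curve `U₀/𝔽_q` carrying a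
non-degenerate alternating form `ψ : ℱ₀ ⊗ ℱ₀ → ℚ_ℓ(-β)` with open (big) geometric monodromy and
rational local characteristic polynomials `det(1 - F_x t, ℱ₀)`, `ℱ₀` is pure of weight `β`. The
proof ("catalysé par la lecture de Rankin") combines sheaf-theoretic inputs — Grothendieck's
formula (1.14.3) for `Z(U₀, ⊗²ᵏ ℱ₀, t)`, `H⁰_c = 0` and `H²_c =` coinvariants (2.10), H. Weyl's
invariant theory for `Sp` — with four elementary lemmas (3.3)–(3.6) on power series with
non-negative coefficients and a limiting argument `k → ∞` (p. 285). This file PROVES the elementary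
part, in a form directly applicable once the sheaf-theoretic inputs exist:

* **(3.3)** `WeilRankin.trace_kronecker_pow`, `trace_kronecker_self_pow_mem_range`:
  `Tr((B ⊗ B)ⁿ) = Tr(Bⁿ)²`, so rational power traces of `F_x | ⊗ᵏ ℱ` give *non-negative* rational
  power traces of `F_x | ⊗²ᵏ ℱ`;
* **(3.4)** `WeilRankin.coeff_inv_charpolyRev_mem` (`_range_nnratCast`): if all `Tr(Aᵐ⁺¹)` lie in a
  subsemiring `C ∋ (n+1)⁻¹` (e.g. `ℚ_{≥0}`), so do all coefficients of `det(1 - tA)⁻¹ ∈ K⟦t⟧` — via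
  the logarithmic derivative `g' = g · ∑ Tr(Aᵐ⁺¹)tᵐ` ((1.5.3), `derivative_inv_charpolyRev`, from
  `FrobeniusTrace.derivative_charpolyRev`) and the recursion `(n+1) g_{n+1} = ∑ g_a Tr(A^{b+1})`;
* **(3.5)** `WeilRankin.coeff_le_coeff_mul`, `coeff_le_coeff_prod`,
  `coeff_le_of_eventually_coeff_prod_eq`: in a (finite, or coefficientwise-stabilising infinite)
  product of series with non-negative real coefficients and constant term `1`, each factor is
  coefficientwise `≤` the product;
* **(3.6)** `WeilRankin.summable_norm_coeff_of_mul_one_sub_pow_eq`: `h · (1 - ct)ᴺ = R` (a rational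
  function with its only pole at `1/c`) gives `∑ ‖h_n‖ rⁿ < ∞` for `r < 1/|c|`;
  `WeilRankin.not_isRoot_of_summable_norm_coeff`: if `f = 1/P` and `∑ ‖f_n‖ rⁿ < ∞` then `P` has no
  zero of modulus `≤ r` (Cauchy product of absolutely convergent series);
* **end of the proof of (3.2)** (p. 285) `WeilRankin.sq_le_of_forall_pow_le` (`k → ∞`),
  `WeilRankin.norm_le_of_rankin` (the assembled bound `|α| ≤ q_x^{β/2}` from the data of all
  `⊗²ᵏ`, `k ≥ 1`), `WeilRankin.norm_eq_of_rankin_of_dual` (with `ψ`: `|α| = q_x^{β/2}`);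
* **(3.8), analytic half** (p. 286) `WeilRankin.summable_norm_coeff_of_inverse_eulerProduct`
  (an inverse Euler product `E = ∏ⱼ (1 - α_j t^{d_j})`, taken coefficientwise, has
  `∑ ‖E_n‖ r'ⁿ < ∞` for `r' < r` as soon as `∑ⱼ |α_j| r^{d_j} < ∞`),
  `WeilRankin.summable_norm_mul_pow_of_card_le` (at most `N qⁿ` factors of degree `n` and
  `|α_j| ≤ q^{d_j β/2}` give this for `q^{1+β/2} r < 1`), and the assembled bound
  `WeilRankin.norm_le_of_inverse_eulerProduct`: if `E · D = 1` with `D` a polynomial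
  (`D = det(1 - F t, H¹_c(U, ℱ))`), every `a` with `D(1/a) = 0` has `|a| ≤ q^{β/2+1}`.

## References

* P. Deligne, *La conjecture de Weil. I*, Publ. Math. IHÉS 43 (1974), 273–307: §3, (3.1)–(3.8),
  pp. 283–286; (1.5.3) p. 276. [Deligne1974]
* R. A. Rankin, *Contributions to the theory of Ramanujan's function τ(n) and similar arithmetical
  functions. II*, Proc. Cambridge Philos. Soc. 35 (1939), 351–372 (Deligne's reference [3]).

## Design notes

* Everything is stated for formal power series (`PowerSeries`), with "radius of absolute
  convergence `≥ ρ`" rendered as `Summable (fun n => ‖coeff n f‖ * r ^ n)` for `0 ≤ r < ρ`; no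
  analytic continuation or meromorphy is used: Deligne's (3.6) is needed only for `R/(1 - ct)ᴺ`
  and for `1/P`, and these two cases are proved directly.
* `norm_le_of_rankin` packages the end of the proof of (3.2) with its inputs as hypotheses
  (for each `k ≥ 1`: the local factor `f = 1/P` of `⊗²ᵏ ℱ` at `x` with its pole `z`,
  `zᵈ α²ᵏ = 1`; the `L`-series `h ≥ f` with `h (1 - q^{kβ+1}t)ᴺ` a polynomial); `q > 0` and
  `β ∈ ℝ` are arbitrary here (in (3.2), `β ∈ ℤ` and `q` is a prime power).
* What is NOT here: the sheaf-theoretic inputs of (3.2)/(3.7)/(3.8) ((1.14.3), (2.10), Weyl,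
  `H⁰_c = H²_c = 0`), the algebraicity half of (3.8) (rationality of `det(1 - F t, H¹_c)`), and
  (3.9) (which needs `j_*ℱ` and Poincaré duality (2.12)).
-/

open PowerSeries Finset
open scoped NNRat
open Literature.AlgebraicGeometry.Motives (FrobeniusTrace.derivative_charpolyRev)

namespace Literature.NumberTheory.LFunctions

namespace WeilRankin

/-! ### (3.3): power traces of tensor powers -/

section Traces

variable {K : Type*} [CommRing K] {ι κ : Type*} [Fintype ι] [Fintype κ]

open scoped Kronecker

/-- `Tr((A ⊗ B)ⁿ) = Tr(Aⁿ) Tr(Bⁿ)` for the Kronecker product. [folklore] -/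
theorem trace_kronecker_pow [DecidableEq ι] [DecidableEq κ] (A : Matrix ι ι K) (B : Matrix κ κ K)
    (n : ℕ) : ((A ⊗ₖ B) ^ n).trace = (A ^ n).trace * (B ^ n).trace := by
  have h : (A ⊗ₖ B) ^ n = (A ^ n) ⊗ₖ (B ^ n) := by
    induction n with
    | zero => simp
    | succ n ih => rw [pow_succ, ih, ← Matrix.mul_kronecker_mul, ← pow_succ, ← pow_succ]
  rw [h, Matrix.trace_kronecker]

/-- If the power traces of `A` and `B` lie in a subsemiring `C`, so do those of `A ⊗ B`
(used to pass from `ℱ` to its tensor powers `⊗²ᵏ ℱ = (⊗ᵏ ℱ) ⊗ (⊗ᵏ ℱ)`). [folklore] -/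
theorem trace_kronecker_pow_mem [DecidableEq ι] [DecidableEq κ] (C : Subsemiring K)
    {A : Matrix ι ι K} {B : Matrix κ κ K} (hA : ∀ n, (A ^ n).trace ∈ C)
    (hB : ∀ n, (B ^ n).trace ∈ C) (n : ℕ) : ((A ⊗ₖ B) ^ n).trace ∈ C := by
  rw [trace_kronecker_pow]; exact mul_mem (hA n) (hB n)

/-- **Deligne (3.3), the positivity input.** If all power traces `Tr(Fⁿ)` of `B` (think
`B = F_x | ⊗ᵏ ℱ`) are rational (hypothesis (iii) of (3.2)), then the power traces of `B ⊗ B`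
(`= F_x | ⊗²ᵏ ℱ`) are *non-negative* rationals: `Tr((B ⊗ B)ⁿ) = Tr(Bⁿ)²`. ("Le nombre
`Tr(F_xⁿ, ⊗²ᵏ ℱ) = Tr(F_xⁿ, ℱ)²ᵏ` est donc rationnel positif.")
[cite: Deligne1974, Lemme (3.3), p. 284] -/
theorem trace_kronecker_self_pow_mem_range {K : Type*} [Field K] [CharZero K] [DecidableEq ι]
    {B : Matrix ι ι K} (hB : ∀ n, (B ^ n).trace ∈ Set.range ((↑) : ℚ → K)) (n : ℕ) :
    ((B ⊗ₖ B) ^ n).trace ∈ Set.range ((↑) : ℚ≥0 → K) := by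
  obtain ⟨s, hs⟩ := hB n
  refine ⟨⟨s ^ 2, sq_nonneg s⟩, ?_⟩
  rw [trace_kronecker_pow, ← hs, ← Rat.cast_nnratCast, NNRat.coe_mk, Rat.cast_pow, sq]

end Traces

/-! ### (3.4): `det(1 - F t)⁻¹` has non-negative coefficients -/

section Positivity

variable {K : Type*} [Field K]

/-- If `g, T ∈ K⟦X⟧` satisfy `g' = g · T`, `g(0) ∈ C` and all coefficients of `T` lie in a
subsemiring `C ∋ (n+1)⁻¹`, then all coefficients of `g` lie in `C`:
`(n + 1) g_{n+1} = ∑_{a+b=n} g_a T_b`. [folklore] -/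
theorem coeff_mem_of_derivative_eq_mul [CharZero K] (C : Subsemiring K) (hC : ∀ n : ℕ, ((n : K) + 1)⁻¹ ∈ C)
    {g T : K⟦X⟧} (hg : d⁄dX K g = g * T) (h0 : constantCoeff g ∈ C)
    (hT : ∀ n, coeff n T ∈ C) (n : ℕ) : coeff n g ∈ C := by
  induction n using Nat.strong_induction_on with
  | _ n ih =>
    cases n with
    | zero => simpa using h0
    | succ n =>
      have h := congrArg (coeff n) hg
      rw [coeff_derivative, coeff_mul] at h
      have hn : ((n : K) + 1) ≠ 0 := Nat.cast_add_one_ne_zero n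
      have e : coeff (n + 1) g =
          (∑ p ∈ antidiagonal n, coeff p.1 g * coeff p.2 T) * ((n : K) + 1)⁻¹ := by
        rw [← h, mul_inv_cancel_right₀ hn]
      rw [e]
      refine mul_mem (sum_mem fun p hp => mul_mem (ih p.1 ?_) (hT p.2)) (hC n)
      have := mem_antidiagonal.mp hp; omega

variable {ι : Type*} [Fintype ι] [DecidableEq ι]

/-- For `P = det(1 - tA)` (`Matrix.charpolyRev`) over a field, `P(0) = 1`, and in `K⟦t⟧` the
inverse `g = P⁻¹` satisfies `g' = g · ∑ₘ Tr(Aᵐ⁺¹) tᵐ` — the logarithmic derivative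
`t (d/dt) log det(1 - tA)⁻¹ = ∑_{n ≥ 1} Tr(Aⁿ) tⁿ` of (1.5.3). [cite: Deligne1974, (1.5.3), p. 276] -/
theorem derivative_inv_charpolyRev (A : Matrix ι ι K) :
    d⁄dX K ((A.charpolyRev : K⟦X⟧)⁻¹) =
      (A.charpolyRev : K⟦X⟧)⁻¹ * PowerSeries.mk fun m => (A ^ (m + 1)).trace := by
  set P : K⟦X⟧ := (A.charpolyRev : K⟦X⟧) with hP
  have hP0 : constantCoeff P = 1 := by
    rw [hP, ← coeff_zero_eq_constantCoeff, Polynomial.coeff_coe,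
      Polynomial.coeff_zero_eq_eval_zero, Matrix.eval_charpolyRev]
  have hPg : P * P⁻¹ = 1 := PowerSeries.mul_inv_cancel P (by rw [hP0]; exact one_ne_zero)
  have hPne : P ≠ 0 := fun h => by simp [h] at hPg
  -- differentiate `P * P⁻¹ = 1`
  have hD := FrobeniusTrace.derivative_charpolyRev A
  rw [← hP] at hD
  have h1 : d⁄dX K (P * P⁻¹) = 0 := by rw [hPg, Derivation.map_one_eq_zero]
  rw [Derivation.leibniz, hD, smul_eq_mul, smul_eq_mul] at h1
  -- `P * D(P⁻¹) = P * (P⁻¹ * T)`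
  apply mul_left_cancel₀ hPne
  have e : P * ((P⁻¹ : K⟦X⟧) * PowerSeries.mk fun m => (A ^ (m + 1)).trace) =
      -(P⁻¹ * -(P * PowerSeries.mk fun m => (A ^ (m + 1)).trace)) := by ring
  rw [e]
  exact eq_neg_of_add_eq_zero_left h1

/-- **Deligne (3.4).** If the power traces `Tr(Aᵐ⁺¹)` of a square matrix `A` over a field of
characteristic zero all lie in a subsemiring `C` containing the `(n+1)⁻¹` (e.g. the non-negative
rationals, by (3.3)), then every coefficient of the "local factor" `det(1 - tA)⁻¹ ∈ K⟦t⟧` lies in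
`C` ("La série formelle `log det(1 - F_x t, ⊗²ᵏ ℱ)⁻¹` est sans terme constant; d'après (3.3), ses
coefficients sont `≥ 0`; les coefficients de son exponentielle sont donc également positifs" — here
via `g' = g · ∑ Tr(Aᵐ⁺¹) tᵐ` instead of `exp ∘ log`). [cite: Deligne1974, Lemme (3.4), p. 284] -/
theorem coeff_inv_charpolyRev_mem [CharZero K] (C : Subsemiring K) (hC : ∀ n : ℕ, ((n : K) + 1)⁻¹ ∈ C)
    (A : Matrix ι ι K) (hA : ∀ m, (A ^ (m + 1)).trace ∈ C) (n : ℕ) :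
    coeff n ((A.charpolyRev : K⟦X⟧)⁻¹) ∈ C := by
  refine coeff_mem_of_derivative_eq_mul C hC (derivative_inv_charpolyRev A) ?_ (fun m => ?_) n
  · rw [PowerSeries.constantCoeff_inv, ← coeff_zero_eq_constantCoeff, Polynomial.coeff_coe,
      Polynomial.coeff_zero_eq_eval_zero, Matrix.eval_charpolyRev, inv_one]
    exact one_mem C
  · rw [coeff_mk]; exact hA m

/-- The subsemiring of `K` generated by the non-negative rationals (the range of `ℚ≥0 → K`)
contains the `(n+1)⁻¹`. [folklore] -/
theorem inv_natCast_add_one_mem_rangeS [CharZero K] (n : ℕ) :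
    ((n : K) + 1)⁻¹ ∈ (NNRat.castHom K).rangeS := by
  refine ⟨((n : ℚ≥0) + 1)⁻¹, ?_⟩
  rw [NNRat.coe_castHom, NNRat.cast_inv, NNRat.cast_add, NNRat.cast_natCast, NNRat.cast_one]

/-- **Deligne (3.4), rational form.** If all `Tr(Aᵐ⁺¹)` are non-negative rationals, then
`det(1 - tA)⁻¹` is a power series with non-negative rational coefficients.
[cite: Deligne1974, Lemme (3.4), p. 284] -/
theorem coeff_inv_charpolyRev_mem_range_nnratCast [CharZero K] (A : Matrix ι ι K)
    (hA : ∀ m, (A ^ (m + 1)).trace ∈ Set.range ((↑) : ℚ≥0 → K)) (n : ℕ) :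
    coeff n ((A.charpolyRev : K⟦X⟧)⁻¹) ∈ Set.range ((↑) : ℚ≥0 → K) := by
  have h := coeff_inv_charpolyRev_mem (NNRat.castHom K).rangeS inv_natCast_add_one_mem_rangeS A
    (fun m => by obtain ⟨q, hq⟩ := hA m; exact ⟨q, by simpa using hq⟩) n
  obtain ⟨q, hq⟩ := h
  exact ⟨q, by simpa using hq⟩

end Positivity

/-! ### (3.5): coefficient domination in a product of series with non-negative coefficients -/

section Domination

/-- A product of power series with non-negative real coefficients has non-negative coefficients.
[folklore] -/
theorem coeff_mul_nonneg {f g : ℝ⟦X⟧} (hf : ∀ n, 0 ≤ coeff n f) (hg : ∀ n, 0 ≤ coeff n g)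
    (n : ℕ) : 0 ≤ coeff n (f * g) := by
  rw [coeff_mul]; exact sum_nonneg fun p _ => mul_nonneg (hf _) (hg _)

/-- A finite product of power series with non-negative real coefficients has non-negative
coefficients. [folklore] -/
theorem coeff_prod_nonneg {ι : Type*} (s : Finset ι) {F : ι → ℝ⟦X⟧}
    (hF : ∀ i ∈ s, ∀ n, 0 ≤ coeff n (F i)) (n : ℕ) : 0 ≤ coeff n (∏ i ∈ s, F i) := by
  classical
  induction s using Finset.induction_on generalizing n with
  | empty => simp only [prod_empty, coeff_one]; split_ifs <;> norm_num
  | insert a s ha ih =>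
    rw [prod_insert ha]
    exact coeff_mul_nonneg (hF a (mem_insert_self a s))
      (fun m => ih (fun i hi => hF i (mem_insert_of_mem hi)) m) n

/-- **Deligne (3.5), two factors.** If `f, g ∈ ℝ⟦t⟧` have non-negative coefficients and `g` has
constant term `1`, then coefficientwise `f ≤ f g` ("Si `f_i = ∑ₙ a_{i,n} tⁿ`, on a en effet
`a_{i,n} ≤ a_n`"). [cite: Deligne1974, Lemme (3.5), p. 284] -/
theorem coeff_le_coeff_mul {f g : ℝ⟦X⟧} (hf : ∀ n, 0 ≤ coeff n f) (hg : ∀ n, 0 ≤ coeff n g)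
    (hg0 : constantCoeff g = 1) (n : ℕ) : coeff n f ≤ coeff n (f * g) := by
  rw [coeff_mul]
  calc coeff n f = coeff (n, 0).1 f * coeff (n, 0).2 g := by
        simp [coeff_zero_eq_constantCoeff, hg0]
    _ ≤ ∑ p ∈ antidiagonal n, coeff p.1 f * coeff p.2 g :=
        single_le_sum (f := fun p : ℕ × ℕ => coeff p.1 f * coeff p.2 g)
          (fun p _ => mul_nonneg (hf _) (hg _)) (by simp)

/-- **Deligne (3.5), finite products.** If the `f_i ∈ ℝ⟦t⟧` (`i ∈ s`) have non-negative
coefficients and constant term `1`, then coefficientwise `f_j ≤ ∏_{i ∈ s} f_i` for `j ∈ s`; in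
particular the radius of (absolute) convergence of `f_j` is at least that of the product.
[cite: Deligne1974, Lemme (3.5), p. 284] -/
theorem coeff_le_coeff_prod {ι : Type*} [DecidableEq ι] (s : Finset ι) {F : ι → ℝ⟦X⟧}
    (hF : ∀ i ∈ s, ∀ n, 0 ≤ coeff n (F i)) (hF0 : ∀ i ∈ s, constantCoeff (F i) = 1) {j : ι}
    (hj : j ∈ s) (n : ℕ) : coeff n (F j) ≤ coeff n (∏ i ∈ s, F i) := by
  rw [← mul_prod_erase s F hj]
  refine coeff_le_coeff_mul (hF j hj) (coeff_prod_nonneg _ fun i hi => hF i (mem_of_mem_erase hi))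
    ?_ n
  rw [map_prod]
  exact prod_eq_one fun i hi => hF0 i (mem_of_mem_erase hi)

/-- **Deligne (3.5), infinite products.** Let `f_i ∈ ℝ⟦t⟧` (`i ∈ ℕ`) have non-negative
coefficients and constant term `1`, and let `f` be their (formal) infinite product, in the sense
that each coefficient of the partial products `∏_{i<m} f_i` is eventually that of `f` (this is the
case when "l'ordre de `f_i - 1` tend vers l'infini avec `i`"). Then coefficientwise `f_j ≤ f`, so
the radius of absolute convergence of `f_j` is at least that of `f`.
[cite: Deligne1974, Lemme (3.5), p. 284] -/
theorem coeff_le_of_eventually_coeff_prod_eq {F : ℕ → ℝ⟦X⟧} {f : ℝ⟦X⟧}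
    (hF : ∀ i n, 0 ≤ coeff n (F i)) (hF0 : ∀ i, constantCoeff (F i) = 1)
    (hlim : ∀ n, ∀ᶠ m in Filter.atTop, coeff n (∏ i ∈ range m, F i) = coeff n f) (j n : ℕ) :
    coeff n (F j) ≤ coeff n f := by
  obtain ⟨N, hN⟩ := Filter.eventually_atTop.1 (hlim n)
  rw [← hN (max N (j + 1)) (le_max_left _ _)]
  exact coeff_le_coeff_prod _ (fun i _ => hF i) (fun i _ => hF0 i)
    (mem_range.2 (lt_of_lt_of_le (Nat.lt_succ_self j) (le_max_right _ _))) n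

end Domination

/-! ### (3.6): radius of absolute convergence versus poles -/

section Convergence

variable {𝕜 : Type*} [RCLike 𝕜]

/-- Absolute convergence of formal products: if `∑ ‖f_n‖ rⁿ` and `∑ ‖g_n‖ rⁿ` converge (`r ≥ 0`),
so does `∑ ‖(fg)_n‖ rⁿ` (Cauchy product). [folklore] -/
theorem summable_norm_coeff_mul {f g : 𝕜⟦X⟧} {r : ℝ} (hr : 0 ≤ r)
    (hf : Summable fun n => ‖coeff n f‖ * r ^ n) (hg : Summable fun n => ‖coeff n g‖ * r ^ n) :
    Summable fun n => ‖coeff n (f * g)‖ * r ^ n := by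
  have hf' : Summable fun n => ‖coeff n f * (r : 𝕜) ^ n‖ := by
    simpa [norm_mul, norm_pow, abs_of_nonneg hr] using hf
  have hg' : Summable fun n => ‖coeff n g * (r : 𝕜) ^ n‖ := by
    simpa [norm_mul, norm_pow, abs_of_nonneg hr] using hg
  have h := summable_norm_sum_mul_antidiagonal_of_summable_norm hf' hg'
  refine h.congr fun n => ?_
  have e : ∑ kl ∈ antidiagonal n, coeff kl.1 f * (r : 𝕜) ^ kl.1 * (coeff kl.2 g * (r : 𝕜) ^ kl.2) =
      coeff n (f * g) * (r : 𝕜) ^ n := by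
    rw [coeff_mul, sum_mul]
    refine sum_congr rfl fun kl hkl => ?_
    rw [← mem_antidiagonal.1 hkl, pow_add]; ring
  rw [e, norm_mul, norm_pow, RCLike.norm_ofReal, abs_of_nonneg hr]

/-- Powers: if `∑ ‖f_n‖ rⁿ` converges then so does `∑ ‖(f^N)_n‖ rⁿ`. [folklore] -/
theorem summable_norm_coeff_pow {f : 𝕜⟦X⟧} {r : ℝ} (hr : 0 ≤ r)
    (hf : Summable fun n => ‖coeff n f‖ * r ^ n) (N : ℕ) :
    Summable fun n => ‖coeff n (f ^ N)‖ * r ^ n := by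
  induction N with
  | zero =>
    refine summable_of_ne_finset_zero (s := {0}) fun n hn => ?_
    rw [pow_zero, coeff_one, if_neg (by simpa using hn), norm_zero, zero_mul]
  | succ N ih => rw [pow_succ]; exact summable_norm_coeff_mul hr ih hf

/-- A polynomial converges absolutely everywhere. [folklore] -/
theorem summable_norm_coeff_coe (R : Polynomial 𝕜) (r : ℝ) :
    Summable fun n => ‖coeff n (R : 𝕜⟦X⟧)‖ * r ^ n := by
  refine summable_of_ne_finset_zero (s := range (R.natDegree + 1)) fun n hn => ?_
  rw [Polynomial.coeff_coe, Polynomial.coeff_eq_zero_of_natDegree_lt, norm_zero, zero_mul]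
  simpa [Nat.lt_succ_iff] using hn

/-- The geometric series `∑ cⁿ tⁿ = (1 - ct)⁻¹`: `(1 - ct) · ∑ cⁿ tⁿ = 1` in `𝕜⟦t⟧`. [folklore] -/
theorem one_sub_C_mul_X_mul_mk_pow (c : 𝕜) :
    (1 - PowerSeries.C c * X) * PowerSeries.mk (fun n => c ^ n) = 1 := by
  ext n
  rw [sub_mul, one_mul, map_sub, mul_assoc, coeff_C_mul, coeff_one]
  cases n with
  | zero => simp
  | succ n => rw [coeff_succ_X_mul, coeff_mk, coeff_mk, pow_succ]; simp [mul_comm]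

/-- The geometric series `∑ cⁿ tⁿ` converges absolutely for `‖c‖ r < 1`. [folklore] -/
theorem summable_norm_coeff_mk_pow (c : 𝕜) {r : ℝ} (hr : 0 ≤ r) (hcr : ‖c‖ * r < 1) :
    Summable fun n => ‖coeff n (PowerSeries.mk fun n => c ^ n)‖ * r ^ n := by
  have h := summable_geometric_of_lt_one (mul_nonneg (norm_nonneg c) hr) hcr
  refine h.congr fun n => ?_
  rw [coeff_mk, norm_pow, mul_pow]

/-- **Deligne (3.6), the meromorphic side, for a pole of known position.** If `h ∈ 𝕜⟦t⟧`
satisfies `h · (1 - ct)ᴺ = R` with `R` a polynomial — i.e. `h` is the Taylor expansion of a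
rational function with no pole except at `t = 1/c` — then `∑ ‖h_n‖ rⁿ < ∞` for every
`0 ≤ r < 1/‖c‖`: the radius of absolute convergence of `h` is at least `1/‖c‖` ("Ces nombres sont
en effet les rayons de convergence absolue"). [cite: Deligne1974, Lemme (3.6), p. 284] -/
theorem summable_norm_coeff_of_mul_one_sub_pow_eq {h : 𝕜⟦X⟧} {c : 𝕜} {N : ℕ}
    {R : Polynomial 𝕜} (hh : h * (1 - PowerSeries.C c * X) ^ N = (R : 𝕜⟦X⟧)) {r : ℝ} (hr : 0 ≤ r)
    (hcr : ‖c‖ * r < 1) : Summable fun n => ‖coeff n h‖ * r ^ n := by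
  have e : h = (R : 𝕜⟦X⟧) * (PowerSeries.mk fun n => c ^ n) ^ N := by
    rw [← hh, mul_assoc, ← mul_pow, one_sub_C_mul_X_mul_mk_pow, one_pow, mul_one]
  rw [e]
  exact summable_norm_coeff_mul hr (summable_norm_coeff_coe R r)
    (summable_norm_coeff_pow hr (summable_norm_coeff_mk_pow c hr hcr) N)

/-- Comparison: `0 ≤ f_n ≤ h_n` and `∑ ‖h_n‖ rⁿ < ∞` give `∑ ‖f_n‖ rⁿ < ∞` (`r ≥ 0`). [folklore] -/
theorem summable_norm_coeff_of_le {f h : ℝ⟦X⟧} (hf : ∀ n, 0 ≤ coeff n f)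
    (hfh : ∀ n, coeff n f ≤ coeff n h) {r : ℝ} (hr : 0 ≤ r)
    (hs : Summable fun n => ‖coeff n h‖ * r ^ n) : Summable fun n => ‖coeff n f‖ * r ^ n := by
  refine hs.of_nonneg_of_le (fun n => mul_nonneg (norm_nonneg _) (pow_nonneg hr n)) fun n => ?_
  gcongr
  rw [Real.norm_of_nonneg (hf n), Real.norm_of_nonneg ((hf n).trans (hfh n))]
  exact hfh n

/-- **Deligne (3.6), the local-factor side.** If `f ∈ ℂ⟦t⟧` is the inverse of a polynomial `P`
(`f · P = 1`, e.g. `f = det(1 - F_x tᵈ, ⊗²ᵏ ℱ)⁻¹`) and `∑ ‖f_n‖ rⁿ < ∞`, then `P` has no zero in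
the closed disc of radius `r`: the poles `z` of `f` satisfy `r < |z|`
("`inf {|z| : f(z) = ∞} ≥ inf {|z| : f_i(z) = ∞}`; ces nombres sont en effet les rayons de
convergence absolue"). [cite: Deligne1974, Lemme (3.6), p. 284] -/
theorem not_isRoot_of_summable_norm_coeff {f : ℂ⟦X⟧} {P : Polynomial ℂ}
    (hfP : f * (P : ℂ⟦X⟧) = 1)
    {r : ℝ} (hs : Summable fun n => ‖coeff n f‖ * r ^ n) {z : ℂ} (hz : ‖z‖ ≤ r) :
    ¬ P.IsRoot z := by
  intro hroot
  -- the two absolutely convergent series `∑ f_n zⁿ` and `∑ P_m zᵐ = P(z)`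
  set a : ℕ → ℂ := fun n => coeff n f * z ^ n
  set b : ℕ → ℂ := fun n => P.coeff n * z ^ n
  have ha : Summable fun n => ‖a n‖ := by
    refine hs.of_nonneg_of_le (fun n => norm_nonneg _) fun n => ?_
    rw [norm_mul, norm_pow]
    gcongr
  have hb : Summable fun n => ‖b n‖ := by
    refine summable_of_ne_finset_zero (s := range (P.natDegree + 1)) fun n hn => ?_
    simp only [b]
    rw [Polynomial.coeff_eq_zero_of_natDegree_lt (by simpa [Nat.lt_succ_iff] using hn), zero_mul,
      norm_zero]
  have hbsum : ∑' n, b n = P.eval z := by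
    rw [Polynomial.eval_eq_sum_range, tsum_eq_sum (s := range (P.natDegree + 1))]
    intro n hn
    simp only [b]
    rw [Polynomial.coeff_eq_zero_of_natDegree_lt (by simpa [Nat.lt_succ_iff] using hn), zero_mul]
  -- their Cauchy product is `∑ (fP)_n zⁿ = 1`
  have hprod := tsum_mul_tsum_eq_tsum_sum_antidiagonal_of_summable_norm ha hb
  have hone : ∀ n, ∑ kl ∈ antidiagonal n, a kl.1 * b kl.2 = if n = 0 then 1 else 0 := by
    intro n
    have e : ∑ kl ∈ antidiagonal n, a kl.1 * b kl.2 = coeff n (f * (P : ℂ⟦X⟧)) * z ^ n := by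
      rw [coeff_mul, sum_mul]
      refine sum_congr rfl fun kl hkl => ?_
      simp only [a, b, Polynomial.coeff_coe]
      rw [← mem_antidiagonal.1 hkl, pow_add]; ring
    rw [e, hfP, coeff_one]
    split_ifs with h <;> simp [h]
  simp_rw [hone] at hprod
  have h1 : ∑' n : ℕ, (if n = 0 then (1 : ℂ) else 0) = 1 := by
    rw [tsum_eq_single 0 fun n hn => if_neg hn, if_pos rfl]
  rw [h1, hbsum, hroot.eq_zero, mul_zero] at hprod
  exact zero_ne_one hprod

end Convergence

/-! ### End of the proof of (3.2): `k → ∞` and the duality flip -/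

section Assembly

/-- "Faisant tendre `k` vers l'infini": if `x²ᵏ ≤ C · cᵏ` for all `k ≥ 1` (`c > 0`), then
`x² ≤ c`. [cite: Deligne1974, proof of Théorème (3.2), p. 285] -/
theorem sq_le_of_forall_pow_le {x c C : ℝ} (hc : 0 < c)
    (h : ∀ k : ℕ, 0 < k → x ^ (2 * k) ≤ C * c ^ k) : x ^ 2 ≤ c := by
  by_contra hlt
  push Not at hlt
  have hu : 1 < x ^ 2 / c := (one_lt_div hc).2 hlt
  obtain ⟨N, hN⟩ := Filter.eventually_atTop.1
    ((tendsto_pow_atTop_atTop_of_one_lt hu).eventually_gt_atTop C)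
  have hk := hN (N + 1) (Nat.le_succ N)
  have hle : (x ^ 2 / c) ^ (N + 1) ≤ C := by
    rw [div_pow, div_le_iff₀ (pow_pos hc _), ← pow_mul]
    exact h (N + 1) (Nat.succ_pos N)
  exact lt_irrefl C (hk.trans_le hle)

/-- **Deligne, end of the proof of Théorème (3.2)** (p. 285), abstract form. Fix `q > 0`, a weight
`β`, a closed point `x` of degree `d ≥ 1` (`q_x = qᵈ`) and `α ∈ ℂ`, `α ≠ 0` (a complex conjugate of
an eigenvalue of `F_x` on `ℱ`). Suppose that for every `k ≥ 1` we are given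
* `f ∈ ℝ⟦t⟧` with non-negative coefficients and a complex polynomial `P` with `f · P = 1`, having a
  root `z` with `zᵈ α²ᵏ = 1` (the local factor `f = det(1 - F_x tᵈ, ⊗²ᵏ ℱ)⁻¹` of (3.4), of which
  `1/α^{2k/d}` is a pole);
* `h ∈ ℝ⟦t⟧` with `f ≤ h` coefficientwise (the `L`-function `Z(U₀, ⊗²ᵏ ℱ₀, t) = f · ∏_{x' ≠ x}(…)`,
  by (3.5)), and a polynomial `R`, an integer `N` with `h · (1 - q^{kβ+1} t)ᴺ = R` (by (1.14.3),
  `H⁰_c = 0` and `H²_c(U, ⊗²ᵏ ℱ) = Q_ℓ(-kβ-1)ᴺ`: "une fonction rationnelle n'ayant de pôle qu'en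
  `t = 1/q^{kβ+1}`").
Then `|α| ≤ q_x^{β/2} = q^{dβ/2}`: by (3.6) `|1/α^{2k/d}| ≥ q^{-kβ-1}`, i.e.
`|α| ≤ q_x^{β/2 + 1/2k}`, and `k → ∞`. [cite: Deligne1974, Théorème (3.2) (end of proof), p. 285] -/
theorem norm_le_of_rankin {q : ℝ} (hq : 0 < q) (β : ℝ) {d : ℕ} {α : ℂ}
    (H : ∀ k : ℕ, 0 < k → ∃ (f h : ℝ⟦X⟧) (P : Polynomial ℂ) (R : Polynomial ℝ) (N : ℕ) (z : ℂ),
      (∀ n, 0 ≤ coeff n f) ∧ f.map (algebraMap ℝ ℂ) * (P : ℂ⟦X⟧) = 1 ∧ P.IsRoot z ∧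
      z ^ d * α ^ (2 * k) = 1 ∧ (∀ n, coeff n f ≤ coeff n h) ∧
      h * (1 - PowerSeries.C (q ^ ((k : ℝ) * β + 1)) * X) ^ N = (R : ℝ⟦X⟧)) :
    ‖α‖ ≤ q ^ ((d : ℝ) * β / 2) := by
  -- for each `k ≥ 1`: `|α|^{2k} ≤ qᵈ · (q^{dβ})ᵏ`
  have key : ∀ k : ℕ, 0 < k → ‖α‖ ^ (2 * k) ≤ q ^ (d : ℝ) * (q ^ ((d : ℝ) * β)) ^ k := by
    intro k hk
    obtain ⟨f, h, P, R, N, z, hf, hfP, hroot, hz, hfh, hhR⟩ := H k hk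
    set c : ℝ := q ^ ((k : ℝ) * β + 1) with hc_def
    have hc : 0 < c := Real.rpow_pos_of_pos hq _
    -- (3.6): the pole `z` of the local factor has `|z| ≥ 1/c`
    have hzc : c⁻¹ ≤ ‖z‖ := by
      by_contra hlt
      push Not at hlt
      have hcz : ‖c‖ * ‖z‖ < 1 := by
        rw [Real.norm_of_nonneg hc.le]
        calc c * ‖z‖ < c * c⁻¹ := mul_lt_mul_of_pos_left hlt hc
          _ = 1 := mul_inv_cancel₀ hc.ne'
      have h1 : Summable fun n => ‖coeff n h‖ * ‖z‖ ^ n :=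
        summable_norm_coeff_of_mul_one_sub_pow_eq hhR (norm_nonneg z) hcz
      have h2 : Summable fun n => ‖coeff n f‖ * ‖z‖ ^ n :=
        summable_norm_coeff_of_le hf hfh (norm_nonneg z) h1
      have h3 : Summable fun n => ‖coeff n (f.map (algebraMap ℝ ℂ))‖ * ‖z‖ ^ n := by
        refine h2.congr fun n => ?_
        rw [coeff_map, Complex.coe_algebraMap, Complex.norm_real]
      exact not_isRoot_of_summable_norm_coeff hfP h3 le_rfl hroot
    have hzpos : 0 < ‖z‖ := lt_of_lt_of_le (inv_pos.2 hc) hzc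
    -- `|z|ᵈ |α|^{2k} = 1`, so `|α|^{2k} ≤ cᵈ`
    have hnorm : ‖z‖ ^ d * ‖α‖ ^ (2 * k) = 1 := by
      simpa [norm_mul, norm_pow] using congrArg norm hz
    have h4 : ‖α‖ ^ (2 * k) ≤ c ^ d := by
      rw [eq_inv_of_mul_eq_one_right hnorm]
      refine (inv_le_comm₀ (pow_pos hzpos d) (pow_pos hc d)).2 ?_
      rw [← inv_pow]
      exact pow_le_pow_left₀ (inv_pos.2 hc).le hzc d
    -- `cᵈ = qᵈ (q^{dβ})ᵏ`
    have e : c ^ d = q ^ (d : ℝ) * (q ^ ((d : ℝ) * β)) ^ k := by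
      rw [hc_def, ← Real.rpow_natCast, ← Real.rpow_mul hq.le, ← Real.rpow_natCast _ k,
        ← Real.rpow_mul hq.le, ← Real.rpow_add hq]
      congr 1; ring
    exact h4.trans e.le
  -- `k → ∞`
  have hsq : ‖α‖ ^ 2 ≤ q ^ ((d : ℝ) * β) :=
    sq_le_of_forall_pow_le (Real.rpow_pos_of_pos hq _) fun k hk => key k hk
  calc ‖α‖ = Real.sqrt (‖α‖ ^ 2) := (Real.sqrt_sq (norm_nonneg α)).symm
    _ ≤ Real.sqrt (q ^ ((d : ℝ) * β)) := Real.sqrt_le_sqrt hsq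
    _ = q ^ ((d : ℝ) * β / 2) := by
        rw [Real.sqrt_eq_rpow, ← Real.rpow_mul hq.le]; ring_nf

/-- If `a b = B²` with `0 ≤ a ≤ B`, `b ≤ B` and `B > 0`, then `a = B`. [folklore] -/
theorem eq_of_mul_eq_sq_of_le {a b B : ℝ} (hB : 0 < B) (ha0 : 0 ≤ a) (hab : a * b = B ^ 2)
    (ha : a ≤ B) (hb : b ≤ B) : a = B := by
  refine le_antisymm ha (le_of_mul_le_mul_right ?_ hB)
  rw [← sq, ← hab]
  exact mul_le_mul_of_nonneg_left hb ha0

/-- **Deligne, Théorème (3.2), last step.** "Par ailleurs, l'existence de `ψ` assure que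
`q_x^β α⁻¹` est également valeur propre, d'où l'inégalité `|q_x^β α⁻¹| ≤ q_x^{β/2}`, soit
`q_x^{β/2} ≤ |α|`": if `α α' = q_x^β = q^{dβ}` and both `|α|, |α'| ≤ q^{dβ/2}`, then
`|α| = q^{dβ/2}`, i.e. `ℱ` is (pure) of weight `β` at `x`.
[cite: Deligne1974, Théorème (3.2) (end of proof), p. 285] -/
theorem norm_eq_of_rankin_of_dual {q : ℝ} (hq : 0 < q) (β : ℝ) (d : ℕ) {α α' : ℂ}
    (hαα' : α * α' = ((q ^ ((d : ℝ) * β) : ℝ) : ℂ)) (h1 : ‖α‖ ≤ q ^ ((d : ℝ) * β / 2))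
    (h2 : ‖α'‖ ≤ q ^ ((d : ℝ) * β / 2)) : ‖α‖ = q ^ ((d : ℝ) * β / 2) := by
  refine eq_of_mul_eq_sq_of_le (Real.rpow_pos_of_pos hq _) (norm_nonneg α) ?_ h1 h2
  rw [← norm_mul, hαα', Complex.norm_real, Real.norm_of_nonneg (Real.rpow_nonneg hq.le _),
    ← Real.rpow_natCast, ← Real.rpow_mul hq.le]
  congr 1; push_cast; ring

end Assembly

/-! ### (3.8): inverse Euler products converge absolutely where `∑ |α_j| r^{d_j}` does -/

section EulerProduct

variable {ι : Type*}

/-- Coefficient bound for a finite inverse Euler product: for `E_s = ∏_{j ∈ s} (1 - α_j t^{d_j})`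
and `r ≥ 0`, `‖(E_s)_n‖ rⁿ ≤ ∏_{j ∈ s} (1 + |α_j| r^{d_j})` for every `n` (majorant
`∏ (1 + |α_j| t^{d_j})` evaluated at `r`). [folklore] -/
theorem norm_coeff_prod_one_sub_mul_le [DecidableEq ι] (s : Finset ι) (α : ι → ℂ) (d : ι → ℕ)
    {r : ℝ} (hr : 0 ≤ r) (n : ℕ) :
    ‖coeff n (∏ j ∈ s, (1 - PowerSeries.C (α j) * X ^ d j) : ℂ⟦X⟧)‖ * r ^ n ≤
      ∏ j ∈ s, (1 + ‖α j‖ * r ^ d j) := by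
  induction s using Finset.induction_on generalizing n with
  | empty =>
    simp only [prod_empty, coeff_one]
    split_ifs with h
    · simp [h]
    · simp
  | insert a s ha ih =>
    set P : ℂ⟦X⟧ := ∏ j ∈ s, (1 - PowerSeries.C (α j) * X ^ d j) with hP
    set B : ℝ := ∏ j ∈ s, (1 + ‖α j‖ * r ^ d j) with hB
    have hB0 : 0 ≤ B := prod_nonneg fun j _ => by positivity
    have hcoeff : coeff n ((1 - PowerSeries.C (α a) * X ^ d a) * P) =
        coeff n P - α a * (if d a ≤ n then coeff (n - d a) P else 0) := by
      rw [sub_mul, one_mul, map_sub, mul_assoc, coeff_C_mul, coeff_X_pow_mul']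
    rw [prod_insert ha, prod_insert ha, hcoeff]
    split_ifs with hdn
    · have e : r ^ n = r ^ d a * r ^ (n - d a) := by rw [← pow_add, Nat.add_sub_cancel' hdn]
      calc ‖coeff n P - α a * coeff (n - d a) P‖ * r ^ n
          ≤ (‖coeff n P‖ + ‖α a‖ * ‖coeff (n - d a) P‖) * r ^ n := by
            gcongr
            exact (norm_sub_le _ _).trans (by rw [norm_mul])
        _ = ‖coeff n P‖ * r ^ n + ‖α a‖ * r ^ d a * (‖coeff (n - d a) P‖ * r ^ (n - d a)) := by
            rw [e]; ring
        _ ≤ B + ‖α a‖ * r ^ d a * B := by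
            gcongr
            · exact ih n
            · exact ih (n - d a)
        _ = (1 + ‖α a‖ * r ^ d a) * B := by ring
    · rw [mul_zero, sub_zero]
      calc ‖coeff n P‖ * r ^ n ≤ B := ih n
        _ ≤ (1 + ‖α a‖ * r ^ d a) * B :=
            le_mul_of_one_le_left hB0 (le_add_of_nonneg_right (by positivity))

/-- **Absolute convergence of inverse Euler products** (the analytic input of (3.8): "il suffit
de vérifier que le produit infini qui définit `Z(U₀, ℱ₀, t)` converge absolument"). Let
`E ∈ ℂ⟦t⟧` be the formal product `∏_j (1 - α_j t^{d_j})` of a family of local factors, in the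
sense that each coefficient of `E` is that of some finite partial product, and suppose
`∑_j |α_j| r^{d_j} < ∞` for some `r > 0`. Then `∑ ‖E_n‖ r'ⁿ < ∞` for every `0 ≤ r' < r`
(uniformly `‖E_n‖ rⁿ ≤ exp(∑_j |α_j| r^{d_j})`, then compare with a geometric series).
[cite: Deligne1974, proof of Corollaire (3.8), p. 286] -/
theorem summable_norm_coeff_of_inverse_eulerProduct (α : ι → ℂ) (d : ι → ℕ) {E : ℂ⟦X⟧}
    (hE : ∀ n, ∃ s : Finset ι,
      coeff n E = coeff n (∏ j ∈ s, (1 - PowerSeries.C (α j) * X ^ d j) : ℂ⟦X⟧))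
    {r : ℝ} (hr : 0 < r) (hα : Summable fun j => ‖α j‖ * r ^ d j) {r' : ℝ} (hr'0 : 0 ≤ r')
    (hr' : r' < r) : Summable fun n => ‖coeff n E‖ * r' ^ n := by
  classical
  set B : ℝ := Real.exp (∑' j, ‖α j‖ * r ^ d j) with hB
  have hbound : ∀ n, ‖coeff n E‖ * r ^ n ≤ B := fun n => by
    obtain ⟨s, hs⟩ := hE n
    rw [hs]
    refine (norm_coeff_prod_one_sub_mul_le s α d hr.le n).trans ?_
    calc ∏ j ∈ s, (1 + ‖α j‖ * r ^ d j) ≤ ∏ j ∈ s, Real.exp (‖α j‖ * r ^ d j) :=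
          prod_le_prod (fun j _ => by positivity) fun j _ => by
            rw [add_comm]; exact Real.add_one_le_exp _
      _ = Real.exp (∑ j ∈ s, ‖α j‖ * r ^ d j) := (Real.exp_sum s _).symm
      _ ≤ B := Real.exp_le_exp.2 (hα.sum_le_tsum s fun j _ => by positivity)
  have hq : r' / r < 1 := (div_lt_one hr).2 hr'
  have hq0 : 0 ≤ r' / r := div_nonneg hr'0 hr.le
  refine ((summable_geometric_of_lt_one hq0 hq).mul_left B).of_nonneg_of_le
    (fun n => by positivity) fun n => ?_
  have e : r' ^ n = r ^ n * (r' / r) ^ n := by rw [← mul_pow, mul_div_cancel₀ r' hr.ne']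
  rw [e, ← mul_assoc]
  exact mul_le_mul_of_nonneg_right (hbound n) (pow_nonneg hq0 n)

/-- If moreover `E · D = 1` for a polynomial `D` (in (3.8): `D = det(1 - F t, H¹_c(U, ℱ)) = Z(U₀, ℱ₀, t)`
by (1.14.3), and `E = 1/Z` is the inverse Euler product), then every root `ω` of `D` has
`|ω| ≥ r`: "le produit infini … converge absolument (donc est non nul) pour `|t| < r`".
[cite: Deligne1974, proof of Corollaire (3.8), p. 286] -/
theorem le_norm_root_of_inverse_eulerProduct (α : ι → ℂ) (d : ι → ℕ) {E : ℂ⟦X⟧}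
    (hE : ∀ n, ∃ s : Finset ι,
      coeff n E = coeff n (∏ j ∈ s, (1 - PowerSeries.C (α j) * X ^ d j) : ℂ⟦X⟧))
    {r : ℝ} (hr : 0 < r) (hα : Summable fun j => ‖α j‖ * r ^ d j) {D : Polynomial ℂ}
    (hED : E * (D : ℂ⟦X⟧) = 1) {ω : ℂ} (hω : D.IsRoot ω) : r ≤ ‖ω‖ := by
  by_contra hlt
  push Not at hlt
  exact not_isRoot_of_summable_norm_coeff hED
    (summable_norm_coeff_of_inverse_eulerProduct α d hE hr hα (norm_nonneg ω) hlt) le_rfl hω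

/-- The counting input of (3.8): if there are at most `N qⁿ` local factors of degree `n`
("sur la droite affine, il y a `qⁿ` points à valeurs dans `𝔽_{qⁿ}`, donc au plus `qⁿ` points
fermés de degré `n`", each contributing `N = rank ℱ` factors) and `|α_j| ≤ q^{d_j β/2}` (weight
`β`, (3.2)), then `∑_j |α_j| r^{d_j} ≤ N ∑ₙ (q^{1+β/2} r)ⁿ < ∞` for `q^{1+β/2} r < 1`.
[cite: Deligne1974, proof of Corollaire (3.8), p. 286] -/
theorem summable_norm_mul_pow_of_card_le (α : ι → ℂ) (d : ι → ℕ) {q : ℝ} (hq : 0 < q) (β : ℝ)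
    (N : ℕ) (hcard : ∀ n, ∃ s : Finset ι, (∀ j, d j = n → j ∈ s) ∧ (s.card : ℝ) ≤ N * q ^ n)
    (hαle : ∀ j, ‖α j‖ ≤ q ^ ((d j : ℝ) * β / 2)) {r : ℝ} (hr : 0 ≤ r)
    (hqr : q ^ (1 + β / 2) * r < 1) : Summable fun j => ‖α j‖ * r ^ d j := by
  classical
  set x : ℝ := q ^ (1 + β / 2) * r with hx
  have hx0 : 0 ≤ x := mul_nonneg (Real.rpow_nonneg hq.le _) hr
  have hgeom : Summable fun n : ℕ => (N : ℝ) * x ^ n :=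
    (summable_geometric_of_lt_one hx0 hqr).mul_left _
  have hpow : ∀ n : ℕ, q ^ n * (q ^ ((n : ℝ) * β / 2) * r ^ n) = x ^ n := fun n => by
    rw [hx, mul_pow, ← Real.rpow_natCast (q ^ (1 + β / 2)) n, ← Real.rpow_mul hq.le, ← mul_assoc,
      ← Real.rpow_natCast q n, ← Real.rpow_add hq]
    congr 2; ring
  refine summable_of_sum_le (c := ∑' n, (N : ℝ) * x ^ n) (fun j => by positivity) fun u => ?_
  have hfib : ∀ n, ∑ j ∈ u with d j = n, ‖α j‖ * r ^ d j ≤ N * x ^ n := by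
    intro n
    obtain ⟨s, hs, hscard⟩ := hcard n
    calc ∑ j ∈ u with d j = n, ‖α j‖ * r ^ d j
        ≤ ∑ j ∈ u with d j = n, q ^ ((n : ℝ) * β / 2) * r ^ n := by
          refine sum_le_sum fun j hj => ?_
          obtain ⟨-, hdj⟩ := mem_filter.1 hj
          rw [← hdj]
          exact mul_le_mul_of_nonneg_right (hαle j) (pow_nonneg hr _)
      _ = ((u.filter fun j => d j = n).card : ℝ) * (q ^ ((n : ℝ) * β / 2) * r ^ n) := by
          rw [sum_const, nsmul_eq_mul]
      _ ≤ ((N : ℝ) * q ^ n) * (q ^ ((n : ℝ) * β / 2) * r ^ n) := by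
          gcongr
          calc ((u.filter fun j => d j = n).card : ℝ) ≤ s.card := by
                exact_mod_cast card_le_card fun j hj => hs j (mem_filter.1 hj).2
            _ ≤ N * q ^ n := hscard
      _ = N * x ^ n := by rw [mul_assoc, hpow]
  calc ∑ j ∈ u, ‖α j‖ * r ^ d j
      = ∑ n ∈ u.image d, ∑ j ∈ u with d j = n, ‖α j‖ * r ^ d j :=
        (sum_fiberwise_of_maps_to (fun j hj => mem_image_of_mem d hj) _).symm
    _ ≤ ∑ n ∈ u.image d, (N : ℝ) * x ^ n := sum_le_sum fun n _ => hfib n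
    _ ≤ ∑' n, (N : ℝ) * x ^ n := hgeom.sum_le_tsum _ fun n _ => by positivity

/-- **Deligne, Corollaire (3.8)** (the bound `|α| ≤ q^{β/2 + 1}` for the eigenvalues of `F` on
`H¹_c(U, ℱ)`), analytic half, abstract form. Let `ℱ` have local factors `(1 - α_j t^{d_j})`
(`j` running over closed points with multiplicity `N = rank ℱ`), with `|α_j| ≤ q^{d_j β/2}`
(weight `β`, Théorème (3.2)) and at most `N qⁿ` indices of degree `n`; let `E = ∏_j (1 - α_j t^{d_j})`
coefficientwise and `E · D = 1` with `D` a polynomial (`D = Z(U₀, ℱ₀, t) = det(1 - F t, H¹_c(U, ℱ))`,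
(1.14.3) with `H⁰_c = H²_c = 0`). Then every `a ≠ 0` with `D(1/a) = 0` — every eigenvalue of `F`
on `H¹_c` — satisfies `|a| ≤ q^{β/2 + 1}`. (The other half of (3.8), algebraicity of `a`, is the
rationality of `D`.) [cite: Deligne1974, Corollaire (3.8), p. 286] -/
theorem norm_le_of_inverse_eulerProduct (α : ι → ℂ) (d : ι → ℕ) {q : ℝ} (hq : 0 < q) (β : ℝ)
    (N : ℕ) (hcard : ∀ n, ∃ s : Finset ι, (∀ j, d j = n → j ∈ s) ∧ (s.card : ℝ) ≤ N * q ^ n)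
    (hαle : ∀ j, ‖α j‖ ≤ q ^ ((d j : ℝ) * β / 2)) {E : ℂ⟦X⟧}
    (hE : ∀ n, ∃ s : Finset ι,
      coeff n E = coeff n (∏ j ∈ s, (1 - PowerSeries.C (α j) * X ^ d j) : ℂ⟦X⟧))
    {D : Polynomial ℂ} (hED : E * (D : ℂ⟦X⟧) = 1) {a : ℂ} (ha : a ≠ 0) (hroot : D.IsRoot a⁻¹) :
    ‖a‖ ≤ q ^ (β / 2 + 1) := by
  classical
  set ρ : ℝ := (q ^ (1 + β / 2))⁻¹ with hρ
  have hc : 0 < q ^ (1 + β / 2) := Real.rpow_pos_of_pos hq _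
  have hρ0 : 0 < ρ := inv_pos.2 hc
  -- every `r < ρ` is `≤ ‖a⁻¹‖`
  have key : ρ ≤ ‖a⁻¹‖ := by
    refine le_of_forall_lt_imp_le_of_dense fun r hr => ?_
    rcases le_or_gt r 0 with hr0 | hr0
    · exact hr0.trans (norm_nonneg _)
    have hqr : q ^ (1 + β / 2) * r < 1 := by
      calc q ^ (1 + β / 2) * r < q ^ (1 + β / 2) * ρ := mul_lt_mul_of_pos_left hr hc
        _ = 1 := mul_inv_cancel₀ hc.ne'
    exact le_norm_root_of_inverse_eulerProduct α d hE hr0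
      (summable_norm_mul_pow_of_card_le α d hq β N hcard hαle hr0.le hqr) hED hroot
  rw [norm_inv] at key
  have ha0 : 0 < ‖a‖ := norm_pos_iff.2 ha
  rw [hρ, inv_le_inv₀ hc ha0] at key
  rwa [add_comm] at key

end EulerProduct

end WeilRankin

end Literature.NumberTheory.LFunctions
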